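import Mathlib
import HarnessLib
import Summits.HubbardSuperconductivity.HubbardSuperconductivity.Theorems.KLProgrammeKLRegimeVolumeLimitPerLabel
import Summits.HubbardSuperconductivity.HubbardSuperconductivity.Theorems.KLProgrammeKLRegimeVolumeLimitTwoPointTimeC2
import Summits.HubbardSuperconductivity.HubbardSuperconductivity.Theorems.KLProgrammeKLRegimeVolumeLimitTwoPointBareBound
import Summits.HubbardSuperconductivity.HubbardSuperconductivity.Theorems.KLProgrammeKLRegimeVolumeLimitSixHamiltonian

/-!
# VL children of ANY generation: the bound and six-point-bound stub TEXTS are THEOREMS for every bundle `Pr` and window `W`; the child then owes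
# exactly ONE carrier export (arbitrary-pair / nested / per-label nested / position-space form)
# (cell gate-hubbard-kl, seat hubbard-kl-k3c5-p3 g5 — gen-6 co-registrant of the VL child per plan g14 (R15); `--supports` stmt-…-19921)

GEN-6 PREPARATION (plan g14 (R12)/(R15): K3 is resplit onto `klPredsV15`; the VL child re-registers «cauchy v4»).  Two of the three «cauchy» v3 stub texts are
bundle-FREE theorems already: the bound (k3c4-p2 p495604 via (H1) `MatsubaraAllU.twoPoint_H1` + k3c5-p2 `bareFrameBound_of_H1` + the frame transfer
`uniformBound_frame_transfer`, which needs NO admissibility of `K`) and the six-point bound (k3c5-p1 `norm_klSixInf_le_beta`, every `U ≠ 0`, `L ≥ 3`).  Here they are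
stated and PROVED once for every `(Pr, W)` — so the v4 skeleton of the gen-6 VL child can be born with ONE stub (`stub_vl_carrierRate` in the new prefix) —
and the four carrier-export forms of this lineage are packaged as one-line closers of `VolumeLimitP2 Pr FinalTwoLegVolLimitEx W`:

* `boundText_holds (Pr W)`, `sixBoundText_holds (Pr W)` — the two stub texts, PROVED for every bundle and window;
* `volumeLimitP2_of_carrierText (Pr W) hPr hcar` — the child from the ONE carrier export (arbitrary pairs; `hPr : Pr.frameOK ⇒ FrameOK`);
* `volumeLimitP2_of_nestedCarrierText` / `_of_perLabelNestedText` / `_of_sitePeriodisationText` — the child from the nested / per-label nested / position-space forms;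
* §3 FRAMED (the engine's own frame `K`, k3c5-p2's (D1) geometry made bundle-generic; NO frame-class hypothesis): `finalTwoLegVolLimitEx_of_framedCarrierRate_point`,
  `volumeLimitP2_of_framedCarrierText`, `volumeLimitP2_of_framedNestedText`, `volumeLimitP2_of_framedSitePeriodisationText`.

Everything is proved; no definition; nothing is asserted about the model.
-/

noncomputable section

namespace Summit.HubbardSuperconductivity.HubbardSuperconductivity.Theorems.TwoPointAssembly

set_option linter.dupNamespace false -- summit = problem name (single-conjunct summit), D-0017

open Finset Filter Topology Literature.MathematicalPhysics.QuantumLattice Literature.Probability.LatticeModels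
open Literature.MathematicalPhysics.QuantumLattice.FermiRG
open Summit.HubbardSuperconductivity.HubbardSuperconductivity.Theorems.DispersionFlow
open Summit.HubbardSuperconductivity.HubbardSuperconductivity.Theorems.KLRegimeSplit
open Summit.HubbardSuperconductivity.HubbardSuperconductivity.Theorems.KLProgrammeLegKernels

/-! ## §1 The two bundle-free stub texts, proved for every bundle and window -/

/-- **The `stub_vl_bound` TEXT holds for every bundle `Pr` and window `W`** (the (H1) route: bare-frame bound + frame transfer; no admissibility of `K` used). -/
theorem boundText_holds (Pr : Preds) (W : Set ℝ) :
    ∀ (G : GeoConsts) (P : SplitConsts) (Q : EngConsts) (R : RenConsts), G.WF → P.WF → Q.WF → R.WF →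
      ∃ c₅ : ℝ, 0 < c₅ ∧ ∀ c : ℝ, 0 < c → c ≤ c₅ → ∃ U₀ : ℝ, 0 < U₀ ∧
        ∀ μ ∈ W, ∀ U : ℝ, 0 < U → U ≤ U₀ → ∀ β : ℝ, klBetaMin ≤ β → β ≤ Real.exp (c / U ^ 2) →
          ∀ K : TrigPolyC4v, Pr.frameOK R U (nScales β) μ K →
            ∀ (Lstar : ℕ) (Mstar : ℕ → ℕ), TowerP Pr G P Q R β U μ K Lstar Mstar →
              ∃ B : ℝ, ∃ L₀ : ℕ, ∃ Mth : ℕ → ℕ, ∀ (L : ℕ) [NeZero L], L₀ ≤ L → ∀ (M : ℕ) [NeZero M], Mth L ≤ M →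
                ∀ (k : FreqMomentum L M) (σ : Fin 2), ‖klSelfEnergy L M β U μ K klE0 (nScales β + 1) k σ‖ ≤ B := by
  intro G P Q R _ _ _ _
  refine ⟨1, one_pos, fun c _ _ => ⟨1, one_pos, ?_⟩⟩
  intro μ _ U _ _ β hβmin _ K _ Lstar Mstar _
  have hβ : 0 < β := pos_of_klBetaMin_le hβmin
  obtain ⟨B₀, L₀, Mth, h0⟩ := bareFrameBound_of_H1 MatsubaraAllU.twoPoint_H1 β hβ U μ
  have h0' : ∀ (L : ℕ) [NeZero L], L₀ ≤ L → ∀ (M : ℕ) [NeZero M], Mth L ≤ M →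
      ∀ (k : FreqMomentum L M) (σ : Fin 2), ‖klSelfEnergy L M β U μ 0 klE0 (nScales β + 1) k σ‖ ≤ B₀ := by
    intro L _ hL M _ hM k σ
    rw [klSelfEnergy_nScales_succ_spin_eq]
    exact h0 L hL M hM k
  exact ⟨_, L₀, Mth, uniformBound_frame_transfer hβ U μ K 0 h0'⟩

/-- **The `stub_vl_sixBound` TEXT holds for every bundle `Pr` and window `W`** (k3c5-p1's coupling-uniform Hamiltonian bound `‖klSixInf‖ ≤ 9β/4`, `U ≠ 0`, `L ≥ 3`). -/
theorem sixBoundText_holds (Pr : Preds) (W : Set ℝ) :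
    ∀ (G : GeoConsts) (P : SplitConsts) (Q : EngConsts) (R : RenConsts), G.WF → P.WF → Q.WF → R.WF →
      ∃ c₅ : ℝ, 0 < c₅ ∧ ∀ c : ℝ, 0 < c → c ≤ c₅ → ∃ U₀ : ℝ, 0 < U₀ ∧
        ∀ μ ∈ W, ∀ U : ℝ, 0 < U → U ≤ U₀ → ∀ β : ℝ, klBetaMin ≤ β → β ≤ Real.exp (c / U ^ 2) →
          ∀ K : TrigPolyC4v, Pr.frameOK R U (nScales β) μ K →
            ∀ (Lstar : ℕ) (Mstar : ℕ → ℕ), TowerP Pr G P Q R β U μ K Lstar Mstar →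
              ∃ L₀ : ℕ, ∃ B : ℝ, ∀ (L : ℕ) [NeZero L], L₀ ≤ L → ∀ (n : ℤ) (k : TorusSite 2 L), ‖klSixInf L β U μ n k‖ ≤ B := by
  intro G P Q R _ _ _ _
  refine ⟨1, one_pos, fun c _ _ => ⟨1, one_pos, ?_⟩⟩
  intro μ _ U hU _ β hβmin _ K _ _ _ _
  exact ⟨3, 9 / 4 * β, fun L _ hL n k => norm_klSixInf_le_beta hL (pos_of_klBetaMin_le hβmin) hU.ne' μ n k⟩

/-! ## §2 One-line closers of a VL child from ONE carrier export, in each of the four forms -/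

/-- **A VL child from ONE carrier export (arbitrary volume pairs).** -/
theorem volumeLimitP2_of_carrierText (Pr : Preds) (W : Set ℝ)
    (hPr : ∀ (R : RenConsts) (U : ℝ) (N : ℕ) (μ : ℝ) (K : TrigPolyC4v), Pr.frameOK R U N μ K → FrameOK R U N μ K)
    (hcar : ∀ (G : GeoConsts) (P : SplitConsts) (Q : EngConsts) (R : RenConsts), G.WF → P.WF → Q.WF → R.WF →
      ∃ c₅ : ℝ, 0 < c₅ ∧ ∀ c : ℝ, 0 < c → c ≤ c₅ → ∃ U₀ : ℝ, 0 < U₀ ∧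
        ∀ μ ∈ W, ∀ U : ℝ, 0 < U → U ≤ U₀ → ∀ β : ℝ, klBetaMin ≤ β → β ≤ Real.exp (c / U ^ 2) →
          ∀ K : TrigPolyC4v, Pr.frameOK R U (nScales β) μ K →
            ∀ (Lstar : ℕ) (Mstar : ℕ → ℕ), TowerP Pr G P Q R β U μ K Lstar Mstar →
              ∃ L₀ : ℕ, ∃ D : ℝ, ∃ ρ : ℕ → ℝ, Tendsto ρ atTop (𝓝 0) ∧
                ∀ (L : ℕ) [NeZero L], L₀ ≤ L → ∀ (L' : ℕ) [NeZero L'], L ≤ L' → ∃ M₀ : ℕ, ∀ (M : ℕ) [NeZero M], M₀ ≤ M →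
                  ∀ (ω : MatsubaraIdx M) (k : TorusSite 2 L) (k' : TorusSite 2 L'),
                    ‖klSelfEnergy L M β U μ 0 klE0 (nScales β + 1) (ω, k) 0 -
                        klSelfEnergy L' M β U μ 0 klE0 (nScales β + 1) (ω, k') 0‖ ≤
                      ρ L + D * ∑ i, torusAbs (latticeMomentum L k i - latticeMomentum L' k' i)) :
    VolumeLimitP2 Pr FinalTwoLegVolLimitEx W :=
  volumeLimitP2_of_carrierTexts Pr W hPr (boundText_holds Pr W) (sixBoundText_holds Pr W) hcar

/-- **A VL child from the NESTED carrier export** (`L ∣ L″`, equal momenta, common cutoff) + the one-volume modulus. -/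
theorem volumeLimitP2_of_nestedCarrierText (Pr : Preds) (W : Set ℝ)
    (hPr : ∀ (R : RenConsts) (U : ℝ) (N : ℕ) (μ : ℝ) (K : TrigPolyC4v), Pr.frameOK R U N μ K → FrameOK R U N μ K)
    (hN : ∀ (G : GeoConsts) (P : SplitConsts) (Q : EngConsts) (R : RenConsts), G.WF → P.WF → Q.WF → R.WF →
      ∃ c₅ : ℝ, 0 < c₅ ∧ ∀ c : ℝ, 0 < c → c ≤ c₅ → ∃ U₀ : ℝ, 0 < U₀ ∧
        ∀ μ ∈ W, ∀ U : ℝ, 0 < U → U ≤ U₀ → ∀ β : ℝ, klBetaMin ≤ β → β ≤ Real.exp (c / U ^ 2) →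
          ∀ K : TrigPolyC4v, Pr.frameOK R U (nScales β) μ K →
            ∀ (Lstar : ℕ) (Mstar : ℕ → ℕ), TowerP Pr G P Q R β U μ K Lstar Mstar →
              ∃ L₀ : ℕ, ∃ ρ : ℕ → ℝ, Tendsto ρ atTop (𝓝 0) ∧
                ∀ (L : ℕ) [NeZero L], L₀ ≤ L → ∀ (L'' : ℕ) [NeZero L''], L ∣ L'' → ∃ M₀ : ℕ, ∀ (M : ℕ) [NeZero M], M₀ ≤ M →
                  ∀ (ω : MatsubaraIdx M) (k : TorusSite 2 L) (k'' : TorusSite 2 L''), latticeMomentum L'' k'' = latticeMomentum L k →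
                    ‖klSelfEnergy L M β U μ 0 klE0 (nScales β + 1) (ω, k) 0 -
                        klSelfEnergy L'' M β U μ 0 klE0 (nScales β + 1) (ω, k'') 0‖ ≤ ρ L)
    (hM : ∀ (G : GeoConsts) (P : SplitConsts) (Q : EngConsts) (R : RenConsts), G.WF → P.WF → Q.WF → R.WF →
      ∃ c₅ : ℝ, 0 < c₅ ∧ ∀ c : ℝ, 0 < c → c ≤ c₅ → ∃ U₀ : ℝ, 0 < U₀ ∧
        ∀ μ ∈ W, ∀ U : ℝ, 0 < U → U ≤ U₀ → ∀ β : ℝ, klBetaMin ≤ β → β ≤ Real.exp (c / U ^ 2) →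
          ∀ K : TrigPolyC4v, Pr.frameOK R U (nScales β) μ K →
            ∀ (Lstar : ℕ) (Mstar : ℕ → ℕ), TowerP Pr G P Q R β U μ K Lstar Mstar →
              ∃ L₀ : ℕ, ∃ D : ℝ, ∃ ρ' : ℕ → ℝ, Tendsto ρ' atTop (𝓝 0) ∧
                ∀ (L : ℕ) [NeZero L], L₀ ≤ L → ∃ M₀ : ℕ, ∀ (M : ℕ) [NeZero M], M₀ ≤ M →
                  ∀ (ω : MatsubaraIdx M) (k₁ k₂ : TorusSite 2 L),
                    ‖klSelfEnergy L M β U μ 0 klE0 (nScales β + 1) (ω, k₁) 0 -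
                        klSelfEnergy L M β U μ 0 klE0 (nScales β + 1) (ω, k₂) 0‖ ≤
                      ρ' L + D * ∑ i, torusAbs (latticeMomentum L k₁ i - latticeMomentum L k₂ i)) :
    VolumeLimitP2 Pr FinalTwoLegVolLimitEx W :=
  volumeLimitP2_of_carrierText Pr W hPr (carrierRateText_of_nested Pr W hN hM)

/-- **A VL child from the PER-LABEL NESTED carrier export** (label-dependent rates `ρ n`) + the one-volume modulus. -/
theorem volumeLimitP2_of_perLabelNestedText (Pr : Preds) (W : Set ℝ)
    (hPr : ∀ (R : RenConsts) (U : ℝ) (N : ℕ) (μ : ℝ) (K : TrigPolyC4v), Pr.frameOK R U N μ K → FrameOK R U N μ K)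
    (hN : ∀ (G : GeoConsts) (P : SplitConsts) (Q : EngConsts) (R : RenConsts), G.WF → P.WF → Q.WF → R.WF →
      ∃ c₅ : ℝ, 0 < c₅ ∧ ∀ c : ℝ, 0 < c → c ≤ c₅ → ∃ U₀ : ℝ, 0 < U₀ ∧
        ∀ μ ∈ W, ∀ U : ℝ, 0 < U → U ≤ U₀ → ∀ β : ℝ, klBetaMin ≤ β → β ≤ Real.exp (c / U ^ 2) →
          ∀ K : TrigPolyC4v, Pr.frameOK R U (nScales β) μ K →
            ∀ (Lstar : ℕ) (Mstar : ℕ → ℕ), TowerP Pr G P Q R β U μ K Lstar Mstar →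
              ∃ L₀ : ℕ, ∃ ρ : ℤ → ℕ → ℝ, (∀ n, Tendsto (ρ n) atTop (𝓝 0)) ∧
                ∀ (n : ℤ) (L : ℕ) [NeZero L], L₀ ≤ L → ∀ (L'' : ℕ) [NeZero L''], L ∣ L'' → ∃ M₀ : ℕ, ∀ (M : ℕ) [NeZero M], M₀ ≤ M →
                  ∀ (ω : MatsubaraIdx M), matsubaraInt M ω = n → ∀ (k : TorusSite 2 L) (k'' : TorusSite 2 L''),
                    latticeMomentum L'' k'' = latticeMomentum L k →
                      ‖klSelfEnergy L M β U μ 0 klE0 (nScales β + 1) (ω, k) 0 -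
                          klSelfEnergy L'' M β U μ 0 klE0 (nScales β + 1) (ω, k'') 0‖ ≤ ρ n L)
    (hM : ∀ (G : GeoConsts) (P : SplitConsts) (Q : EngConsts) (R : RenConsts), G.WF → P.WF → Q.WF → R.WF →
      ∃ c₅ : ℝ, 0 < c₅ ∧ ∀ c : ℝ, 0 < c → c ≤ c₅ → ∃ U₀ : ℝ, 0 < U₀ ∧
        ∀ μ ∈ W, ∀ U : ℝ, 0 < U → U ≤ U₀ → ∀ β : ℝ, klBetaMin ≤ β → β ≤ Real.exp (c / U ^ 2) →
          ∀ K : TrigPolyC4v, Pr.frameOK R U (nScales β) μ K →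
            ∀ (Lstar : ℕ) (Mstar : ℕ → ℕ), TowerP Pr G P Q R β U μ K Lstar Mstar →
              ∃ L₀ : ℕ, ∃ D : ℝ, ∃ ρ' : ℕ → ℝ, Tendsto ρ' atTop (𝓝 0) ∧
                ∀ (L : ℕ) [NeZero L], L₀ ≤ L → ∃ M₀ : ℕ, ∀ (M : ℕ) [NeZero M], M₀ ≤ M →
                  ∀ (ω : MatsubaraIdx M) (k₁ k₂ : TorusSite 2 L),
                    ‖klSelfEnergy L M β U μ 0 klE0 (nScales β + 1) (ω, k₁) 0 -
                        klSelfEnergy L M β U μ 0 klE0 (nScales β + 1) (ω, k₂) 0‖ ≤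
                      ρ' L + D * ∑ i, torusAbs (latticeMomentum L k₁ i - latticeMomentum L k₂ i)) :
    VolumeLimitP2 Pr FinalTwoLegVolLimitEx W :=
  volumeLimitP2_of_carrierText Pr W hPr (carrierRateText_of_perLabelNested Pr W hN hM)

/-- **A VL child from the POSITION-SPACE carrier export** (site kernel against periodised site kernel on nested tori + a first centred site moment). -/
theorem volumeLimitP2_of_sitePeriodisationText (Pr : Preds) (W : Set ℝ)
    (hPr : ∀ (R : RenConsts) (U : ℝ) (N : ℕ) (μ : ℝ) (K : TrigPolyC4v), Pr.frameOK R U N μ K → FrameOK R U N μ K)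
    (hS : ∀ (G : GeoConsts) (P : SplitConsts) (Q : EngConsts) (R : RenConsts), G.WF → P.WF → Q.WF → R.WF →
      ∃ c₅ : ℝ, 0 < c₅ ∧ ∀ c : ℝ, 0 < c → c ≤ c₅ → ∃ U₀ : ℝ, 0 < U₀ ∧
        ∀ μ ∈ W, ∀ U : ℝ, 0 < U → U ≤ U₀ → ∀ β : ℝ, klBetaMin ≤ β → β ≤ Real.exp (c / U ^ 2) →
          ∀ K : TrigPolyC4v, Pr.frameOK R U (nScales β) μ K →
            ∀ (Lstar : ℕ) (Mstar : ℕ → ℕ), TowerP Pr G P Q R β U μ K Lstar Mstar →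
              ∃ L₀ : ℕ, ∃ ρ : ℕ → ℝ, Tendsto ρ atTop (𝓝 0) ∧
                ∀ (L : ℕ) [NeZero L], L₀ ≤ L → ∀ (L'' : ℕ) [NeZero L''] (b : ℕ), L'' = b * L → ∃ M₀ : ℕ, ∀ (M : ℕ) [NeZero M], M₀ ≤ M →
                  ∀ ω : MatsubaraIdx M,
                    ∑ y : TorusSite 2 L,
                      ‖torusFourierInv (fun k : TorusSite 2 L => klSelfEnergy L M β U μ 0 klE0 (nScales β + 1) (ω, k) 0) y -
                        ∑ x ∈ Finset.univ.filter (fun x : TorusSite 2 L'' => (fun i => (((x i).val : ℕ) : ZMod L)) = y),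
                          torusFourierInv (fun k : TorusSite 2 L'' => klSelfEnergy L'' M β U μ 0 klE0 (nScales β + 1) (ω, k) 0) x‖ ≤ ρ L)
    (hD : ∀ (G : GeoConsts) (P : SplitConsts) (Q : EngConsts) (R : RenConsts), G.WF → P.WF → Q.WF → R.WF →
      ∃ c₅ : ℝ, 0 < c₅ ∧ ∀ c : ℝ, 0 < c → c ≤ c₅ → ∃ U₀ : ℝ, 0 < U₀ ∧
        ∀ μ ∈ W, ∀ U : ℝ, 0 < U → U ≤ U₀ → ∀ β : ℝ, klBetaMin ≤ β → β ≤ Real.exp (c / U ^ 2) →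
          ∀ K : TrigPolyC4v, Pr.frameOK R U (nScales β) μ K →
            ∀ (Lstar : ℕ) (Mstar : ℕ → ℕ), TowerP Pr G P Q R β U μ K Lstar Mstar →
              ∃ L₀ : ℕ, ∃ D : ℝ, ∀ (L : ℕ) [NeZero L], L₀ ≤ L → ∃ M₀ : ℕ, ∀ (M : ℕ) [NeZero M], M₀ ≤ M → ∀ ω : MatsubaraIdx M,
                ∑ z : TorusSite 2 L, (∑ i, |(Torus.cRepZ (z i) : ℝ)|) *
                  ‖torusFourierInv (fun k : TorusSite 2 L => klSelfEnergy L M β U μ 0 klE0 (nScales β + 1) (ω, k) 0) z‖ ≤ D) :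
    VolumeLimitP2 Pr FinalTwoLegVolLimitEx W :=
  volumeLimitP2_of_carrierText Pr W hPr (carrierRateText_of_sitePeriodisation Pr W hS hD)

/-- Instance of record (gen 5): the «cauchy» v3 composition of `KLRegimeVolumeLimitV14` needs ONLY the carrier stub. -/
theorem klRegimeVolumeLimitV14_of_carrierText
    (hcar : ∀ (G : GeoConsts) (P : SplitConsts) (Q : EngConsts) (R : RenConsts), G.WF → P.WF → Q.WF → R.WF →
      ∃ c₅ : ℝ, 0 < c₅ ∧ ∀ c : ℝ, 0 < c → c ≤ c₅ → ∃ U₀ : ℝ, 0 < U₀ ∧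
        ∀ μ ∈ klWindowC, ∀ U : ℝ, 0 < U → U ≤ U₀ → ∀ β : ℝ, klBetaMin ≤ β → β ≤ Real.exp (c / U ^ 2) →
          ∀ K : TrigPolyC4v, klPredsV14.frameOK R U (nScales β) μ K →
            ∀ (Lstar : ℕ) (Mstar : ℕ → ℕ), TowerP klPredsV14 G P Q R β U μ K Lstar Mstar →
              ∃ L₀ : ℕ, ∃ D : ℝ, ∃ ρ : ℕ → ℝ, Tendsto ρ atTop (𝓝 0) ∧
                ∀ (L : ℕ) [NeZero L], L₀ ≤ L → ∀ (L' : ℕ) [NeZero L'], L ≤ L' → ∃ M₀ : ℕ, ∀ (M : ℕ) [NeZero M], M₀ ≤ M →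
                  ∀ (ω : MatsubaraIdx M) (k : TorusSite 2 L) (k' : TorusSite 2 L'),
                    ‖klSelfEnergy L M β U μ 0 klE0 (nScales β + 1) (ω, k) 0 -
                        klSelfEnergy L' M β U μ 0 klE0 (nScales β + 1) (ω, k') 0‖ ≤
                      ρ L + D * ∑ i, torusAbs (latticeMomentum L k i - latticeMomentum L' k' i)) :
    VolumeLimitP2 klPredsV14 FinalTwoLegVolLimitEx klWindowC :=
  volumeLimitP2_of_carrierText klPredsV14 klWindowC (fun _ _ _ _ _ h => h) hcar

/-! ## §3 The FRAMED carrier export (the engine's own frame `K`): no frame-class hypothesis at all -/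

/-- **One regime point, FRAMED: a same-cutoff two-volume rate of the frame-`K` last-scale two-leg kernel ⇒ `FinalTwoLegVolLimitEx β U μ K Mstar`**
(`β > 0`; ANY frame `K`, admissible or not: the rate never changes frame, the bound comes from (H1) + the admissibility-free frame transfer). -/
theorem finalTwoLegVolLimitEx_of_framedCarrierRate_point {β U μ : ℝ} {K : TrigPolyC4v} (hβ : 0 < β) (Mstar : ℕ → ℕ)
    (hfr : ∃ L₀ : ℕ, ∃ D : ℝ, ∃ ρ : ℕ → ℝ, Tendsto ρ atTop (𝓝 0) ∧
      ∀ (L : ℕ) [NeZero L], L₀ ≤ L → ∀ (L' : ℕ) [NeZero L'], L ≤ L' → ∃ M₀ : ℕ, ∀ (M : ℕ) [NeZero M], M₀ ≤ M →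
        ∀ (ω : MatsubaraIdx M) (k : TorusSite 2 L) (k' : TorusSite 2 L'),
          ‖klSelfEnergy L M β U μ K klE0 (nScales β + 1) (ω, k) 0 - klSelfEnergy L' M β U μ K klE0 (nScales β + 1) (ω, k') 0‖ ≤
            ρ L + D * ∑ i, torusAbs (latticeMomentum L k i - latticeMomentum L' k' i)) :
    FinalTwoLegVolLimitEx β U μ K Mstar := by
  obtain ⟨L₀, D, ρ, hρ, hS⟩ := hfr
  -- cutoff-free framed rate beyond `max L₀ 3`
  have hinf : ∀ (L : ℕ) [NeZero L], max L₀ 3 ≤ L → ∀ (L' : ℕ) [NeZero L'], L ≤ L' →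
      ∀ (n : ℤ) (k : TorusSite 2 L) (k' : TorusSite 2 L'),
        ‖klSelfEnergyInf L β U μ K n k - klSelfEnergyInf L' β U μ K n k'‖ ≤
          ρ L + D * ∑ i, torusAbs (latticeMomentum L k i - latticeMomentum L' k' i) := by
    intro L _ hL L' _ hLL' n k k'
    have hL3 : 3 ≤ L := le_of_max_le_right hL
    obtain ⟨M₀, hM₀⟩ := hS L (le_of_max_le_left hL) L' hLL'
    exact KLRegimeVolumeLimit.kler_carrierRate_of_sameCutoff hβ U μ K hL3 (hL3.trans hLL') ⟨M₀, fun M _ hM ω _ => hM₀ M hM ω k k'⟩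
  obtain ⟨L₂, Mth, D'', ρ'', hρ'', hrate⟩ := twoVolumeRate_of_cutoffFreeRate hβ U μ K hρ hinf
  -- the bound in the frame `K`: (H1) bare bound + admissibility-free transfer
  obtain ⟨B₀, L₀b, Mthb, h0⟩ := bareFrameBound_of_H1 MatsubaraAllU.twoPoint_H1 β hβ U μ
  have h0' : ∀ (L : ℕ) [NeZero L], L₀b ≤ L → ∀ (M : ℕ) [NeZero M], Mthb L ≤ M →
      ∀ (k : FreqMomentum L M) (σ : Fin 2), ‖klSelfEnergy L M β U μ 0 klE0 (nScales β + 1) k σ‖ ≤ B₀ := by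
    intro L _ hL M _ hM k σ
    rw [klSelfEnergy_nScales_succ_spin_eq]
    exact h0 L hL M hM k
  have hB := uniformBound_frame_transfer hβ U μ K 0 h0'
  exact exists_finalTwoLegVolLimit_of_twoVolumeRate (L₀ := max L₀b L₂) (Mth := fun L => max (Mthb L) (Mth L)) (D := D'') hρ''
    (fun L _ hL M _ hM k σ => hB L (le_of_max_le_left hL) M (le_of_max_le_left hM) k σ)
    (fun L _ hL M _ hM L' _ hLL' M' _ hM' σ ω ω' hωω' k k' =>
      hrate L (le_of_max_le_right hL) M (le_of_max_le_right hM) L' hLL' M' (le_of_max_le_right hM') σ ω ω' hωω' k k')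

/-- **A VL child (any `Pr`, `W`) from ONE FRAMED carrier export** — the engine's own last-scale two-leg kernel in its own frame `K`, arbitrary volume pairs,
common cutoff, cross-grid modulus; NO frame-class hypothesis (k3c5-p2's «cauchy» (D1) geometry, made bundle-generic). -/
theorem volumeLimitP2_of_framedCarrierText (Pr : Preds) (W : Set ℝ)
    (hfr : ∀ (G : GeoConsts) (P : SplitConsts) (Q : EngConsts) (R : RenConsts), G.WF → P.WF → Q.WF → R.WF →
      ∃ c₅ : ℝ, 0 < c₅ ∧ ∀ c : ℝ, 0 < c → c ≤ c₅ → ∃ U₀ : ℝ, 0 < U₀ ∧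
        ∀ μ ∈ W, ∀ U : ℝ, 0 < U → U ≤ U₀ → ∀ β : ℝ, klBetaMin ≤ β → β ≤ Real.exp (c / U ^ 2) →
          ∀ K : TrigPolyC4v, Pr.frameOK R U (nScales β) μ K →
            ∀ (Lstar : ℕ) (Mstar : ℕ → ℕ), TowerP Pr G P Q R β U μ K Lstar Mstar →
              ∃ L₀ : ℕ, ∃ D : ℝ, ∃ ρ : ℕ → ℝ, Tendsto ρ atTop (𝓝 0) ∧
                ∀ (L : ℕ) [NeZero L], L₀ ≤ L → ∀ (L' : ℕ) [NeZero L'], L ≤ L' → ∃ M₀ : ℕ, ∀ (M : ℕ) [NeZero M], M₀ ≤ M →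
                  ∀ (ω : MatsubaraIdx M) (k : TorusSite 2 L) (k' : TorusSite 2 L'),
                    ‖klSelfEnergy L M β U μ K klE0 (nScales β + 1) (ω, k) 0 -
                        klSelfEnergy L' M β U μ K klE0 (nScales β + 1) (ω, k') 0‖ ≤
                      ρ L + D * ∑ i, torusAbs (latticeMomentum L k i - latticeMomentum L' k' i)) :
    VolumeLimitP2 Pr FinalTwoLegVolLimitEx W := by
  intro G P Q R hG hP hQ hR
  obtain ⟨c₅, hc₅, hc⟩ := hfr G P Q R hG hP hQ hR
  refine ⟨c₅, hc₅, fun c hc0 hcc => ?_⟩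
  obtain ⟨U₀, hU₀, hU⟩ := hc c hc0 hcc
  refine ⟨U₀, hU₀, fun μ hμ U hU0 hUU β hβmin hβmax K hK Lstar Mstar hT => ?_⟩
  exact finalTwoLegVolLimitEx_of_framedCarrierRate_point (pos_of_klBetaMin_le hβmin) Mstar
    (hU μ hμ U hU0 hUU β hβmin hβmax K hK Lstar Mstar hT)

/-- **A VL child (any `Pr`, `W`) from the FRAMED NESTED export** (`L ∣ L″`, equal momenta, common cutoff, frame `K`) + a one-volume modulus in the frame `K`. -/
theorem volumeLimitP2_of_framedNestedText (Pr : Preds) (W : Set ℝ)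
    (hN : ∀ (G : GeoConsts) (P : SplitConsts) (Q : EngConsts) (R : RenConsts), G.WF → P.WF → Q.WF → R.WF →
      ∃ c₅ : ℝ, 0 < c₅ ∧ ∀ c : ℝ, 0 < c → c ≤ c₅ → ∃ U₀ : ℝ, 0 < U₀ ∧
        ∀ μ ∈ W, ∀ U : ℝ, 0 < U → U ≤ U₀ → ∀ β : ℝ, klBetaMin ≤ β → β ≤ Real.exp (c / U ^ 2) →
          ∀ K : TrigPolyC4v, Pr.frameOK R U (nScales β) μ K →
            ∀ (Lstar : ℕ) (Mstar : ℕ → ℕ), TowerP Pr G P Q R β U μ K Lstar Mstar →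
              ∃ L₀ : ℕ, ∃ ρ : ℕ → ℝ, Tendsto ρ atTop (𝓝 0) ∧
                ∀ (L : ℕ) [NeZero L], L₀ ≤ L → ∀ (L'' : ℕ) [NeZero L''], L ∣ L'' → ∃ M₀ : ℕ, ∀ (M : ℕ) [NeZero M], M₀ ≤ M →
                  ∀ (ω : MatsubaraIdx M) (k : TorusSite 2 L) (k'' : TorusSite 2 L''), latticeMomentum L'' k'' = latticeMomentum L k →
                    ‖klSelfEnergy L M β U μ K klE0 (nScales β + 1) (ω, k) 0 -
                        klSelfEnergy L'' M β U μ K klE0 (nScales β + 1) (ω, k'') 0‖ ≤ ρ L)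
    (hM : ∀ (G : GeoConsts) (P : SplitConsts) (Q : EngConsts) (R : RenConsts), G.WF → P.WF → Q.WF → R.WF →
      ∃ c₅ : ℝ, 0 < c₅ ∧ ∀ c : ℝ, 0 < c → c ≤ c₅ → ∃ U₀ : ℝ, 0 < U₀ ∧
        ∀ μ ∈ W, ∀ U : ℝ, 0 < U → U ≤ U₀ → ∀ β : ℝ, klBetaMin ≤ β → β ≤ Real.exp (c / U ^ 2) →
          ∀ K : TrigPolyC4v, Pr.frameOK R U (nScales β) μ K →
            ∀ (Lstar : ℕ) (Mstar : ℕ → ℕ), TowerP Pr G P Q R β U μ K Lstar Mstar →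
              ∃ L₀ : ℕ, ∃ D : ℝ, ∃ ρ' : ℕ → ℝ, Tendsto ρ' atTop (𝓝 0) ∧
                ∀ (L : ℕ) [NeZero L], L₀ ≤ L → ∃ M₀ : ℕ, ∀ (M : ℕ) [NeZero M], M₀ ≤ M →
                  ∀ (ω : MatsubaraIdx M) (k₁ k₂ : TorusSite 2 L),
                    ‖klSelfEnergy L M β U μ K klE0 (nScales β + 1) (ω, k₁) 0 -
                        klSelfEnergy L M β U μ K klE0 (nScales β + 1) (ω, k₂) 0‖ ≤
                      ρ' L + D * ∑ i, torusAbs (latticeMomentum L k₁ i - latticeMomentum L k₂ i)) :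
    VolumeLimitP2 Pr FinalTwoLegVolLimitEx W := by
  refine volumeLimitP2_of_framedCarrierText Pr W ?_
  intro G P Q R hG hP hQ hR
  obtain ⟨c₁, hc₁, h₁⟩ := hN G P Q R hG hP hQ hR
  obtain ⟨c₂, hc₂, h₂⟩ := hM G P Q R hG hP hQ hR
  refine ⟨min c₁ c₂, lt_min hc₁ hc₂, fun c hc hcle => ?_⟩
  obtain ⟨U₁, hU₁, h₁'⟩ := h₁ c hc (hcle.trans (min_le_left _ _))
  obtain ⟨U₂, hU₂, h₂'⟩ := h₂ c hc (hcle.trans (min_le_right _ _))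
  refine ⟨min U₁ U₂, lt_min hU₁ hU₂, ?_⟩
  intro μ hμ U hU hUle β hβ hβle K hK Lstar Mstar hT
  obtain ⟨L₁, ρ, hρ, hnest⟩ := h₁' μ hμ U hU (hUle.trans (min_le_left _ _)) β hβ hβle K hK Lstar Mstar hT
  obtain ⟨L₂, D, ρ', hρ', hmod⟩ := h₂' μ hμ U hU (hUle.trans (min_le_right _ _)) β hβ hβle K hK Lstar Mstar hT
  obtain ⟨ρ₂, hρ₂, hrate⟩ := twoVolumeRate_of_nestedRate_cutoff
    (T := fun L M _ _ ω k => klSelfEnergy L M β U μ K klE0 (nScales β + 1) (ω, k) 0) (L₀ := max L₁ L₂) (D := D) hρ hρ'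
    (fun L _ hL L'' _ hdvd => hnest L (le_of_max_le_left hL) L'' hdvd) (fun L _ hL => hmod L (le_of_max_le_right hL))
  exact ⟨max L₁ L₂, D, ρ₂, hρ₂, fun L _ hL L' _ hLL' => hrate L hL L' hLL'⟩

/-- **A VL child (any `Pr`, `W`) from the FRAMED POSITION-SPACE export**: the site kernel `torusFourierInv (Σ̂^K_{L,M}(ω,·))` of the frame-`K` carrier against the
PERIODISED site kernel of the nested volume `b·L` (same cutoff, same label) + an `L`-uniform first centred site moment. -/
theorem volumeLimitP2_of_framedSitePeriodisationText (Pr : Preds) (W : Set ℝ)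
    (hS : ∀ (G : GeoConsts) (P : SplitConsts) (Q : EngConsts) (R : RenConsts), G.WF → P.WF → Q.WF → R.WF →
      ∃ c₅ : ℝ, 0 < c₅ ∧ ∀ c : ℝ, 0 < c → c ≤ c₅ → ∃ U₀ : ℝ, 0 < U₀ ∧
        ∀ μ ∈ W, ∀ U : ℝ, 0 < U → U ≤ U₀ → ∀ β : ℝ, klBetaMin ≤ β → β ≤ Real.exp (c / U ^ 2) →
          ∀ K : TrigPolyC4v, Pr.frameOK R U (nScales β) μ K →
            ∀ (Lstar : ℕ) (Mstar : ℕ → ℕ), TowerP Pr G P Q R β U μ K Lstar Mstar →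
              ∃ L₀ : ℕ, ∃ ρ : ℕ → ℝ, Tendsto ρ atTop (𝓝 0) ∧
                ∀ (L : ℕ) [NeZero L], L₀ ≤ L → ∀ (L'' : ℕ) [NeZero L''] (b : ℕ), L'' = b * L → ∃ M₀ : ℕ, ∀ (M : ℕ) [NeZero M], M₀ ≤ M →
                  ∀ ω : MatsubaraIdx M,
                    ∑ y : TorusSite 2 L,
                      ‖torusFourierInv (fun k : TorusSite 2 L => klSelfEnergy L M β U μ K klE0 (nScales β + 1) (ω, k) 0) y -
                        ∑ x ∈ Finset.univ.filter (fun x : TorusSite 2 L'' => (fun i => (((x i).val : ℕ) : ZMod L)) = y),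
                          torusFourierInv (fun k : TorusSite 2 L'' => klSelfEnergy L'' M β U μ K klE0 (nScales β + 1) (ω, k) 0) x‖ ≤ ρ L)
    (hD : ∀ (G : GeoConsts) (P : SplitConsts) (Q : EngConsts) (R : RenConsts), G.WF → P.WF → Q.WF → R.WF →
      ∃ c₅ : ℝ, 0 < c₅ ∧ ∀ c : ℝ, 0 < c → c ≤ c₅ → ∃ U₀ : ℝ, 0 < U₀ ∧
        ∀ μ ∈ W, ∀ U : ℝ, 0 < U → U ≤ U₀ → ∀ β : ℝ, klBetaMin ≤ β → β ≤ Real.exp (c / U ^ 2) →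
          ∀ K : TrigPolyC4v, Pr.frameOK R U (nScales β) μ K →
            ∀ (Lstar : ℕ) (Mstar : ℕ → ℕ), TowerP Pr G P Q R β U μ K Lstar Mstar →
              ∃ L₀ : ℕ, ∃ D : ℝ, ∀ (L : ℕ) [NeZero L], L₀ ≤ L → ∃ M₀ : ℕ, ∀ (M : ℕ) [NeZero M], M₀ ≤ M → ∀ ω : MatsubaraIdx M,
                ∑ z : TorusSite 2 L, (∑ i, |(Torus.cRepZ (z i) : ℝ)|) *
                  ‖torusFourierInv (fun k : TorusSite 2 L => klSelfEnergy L M β U μ K klE0 (nScales β + 1) (ω, k) 0) z‖ ≤ D) :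
    VolumeLimitP2 Pr FinalTwoLegVolLimitEx W := by
  refine volumeLimitP2_of_framedNestedText Pr W ?_ ?_
  · intro G P Q R hG hP hQ hR
    obtain ⟨c₅, hc₅, hc⟩ := hS G P Q R hG hP hQ hR
    refine ⟨c₅, hc₅, fun c hc0 hcc => ?_⟩
    obtain ⟨U₀, hU₀, hU⟩ := hc c hc0 hcc
    refine ⟨U₀, hU₀, fun μ hμ U hU0 hUU β hβmin hβmax K hK Lstar Mstar hT => ?_⟩
    obtain ⟨L₀, ρ, hρ, hper⟩ := hU μ hμ U hU0 hUU β hβmin hβmax K hK Lstar Mstar hT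
    refine ⟨L₀, ρ, hρ, fun L _ hL L'' _ hdvd => ?_⟩
    obtain ⟨b, hb⟩ := hdvd
    have hM : L'' = b * L := hb.trans (mul_comm _ _)
    obtain ⟨M₀, hM₀⟩ := hper L hL L'' b hM
    refine ⟨M₀, fun M _ hMM ω k k'' hkk => ?_⟩
    rw [eq_torusFourier_torusFourierInv (fun k : TorusSite 2 L => klSelfEnergy L M β U μ K klE0 (nScales β + 1) (ω, k) 0) k,
      eq_torusFourier_torusFourierInv (fun k : TorusSite 2 L'' => klSelfEnergy L'' M β U μ K klE0 (nScales β + 1) (ω, k) 0) k'']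
    exact (norm_torusFourier_sub_torusFourier_of_latticeMomentum_eq hM _ _ hkk).trans (hM₀ M hMM ω)
  · intro G P Q R hG hP hQ hR
    obtain ⟨c₅, hc₅, hc⟩ := hD G P Q R hG hP hQ hR
    refine ⟨c₅, hc₅, fun c hc0 hcc => ?_⟩
    obtain ⟨U₀, hU₀, hU⟩ := hc c hc0 hcc
    refine ⟨U₀, hU₀, fun μ hμ U hU0 hUU β hβmin hβmax K hK Lstar Mstar hT => ?_⟩
    obtain ⟨L₀, D, hmom⟩ := hU μ hμ U hU0 hUU β hβmin hβmax K hK Lstar Mstar hT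
    refine ⟨L₀, D, fun _ => 0, tendsto_const_nhds, fun L _ hL => ?_⟩
    obtain ⟨M₀, hM₀⟩ := hmom L hL
    refine ⟨M₀, fun M _ hMM ω k₁ k₂ => ?_⟩
    rw [zero_add, eq_torusFourier_torusFourierInv (fun k : TorusSite 2 L => klSelfEnergy L M β U μ K klE0 (nScales β + 1) (ω, k) 0) k₁,
      eq_torusFourier_torusFourierInv (fun k : TorusSite 2 L => klSelfEnergy L M β U μ K klE0 (nScales β + 1) (ω, k) 0) k₂]
    refine (norm_torusFourier_sub_torusFourier_le_firstMoment _ k₁ k₂).trans ?_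
    exact mul_le_mul_of_nonneg_right (hM₀ M hMM ω) (klvc_tmod_nonneg _ _)

end Summit.HubbardSuperconductivity.HubbardSuperconductivity.Theorems.TwoPointAssembly

end
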